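import Summits.QuantumFields.QCD.Theorems.QuarksAsStableActionUnquenchedChessboardBoundStubAssemblyAux5
import Mathlib
import HarnessLib

/-!
# Assembly of the unquenched chessboard bound (stub `stub_assembly` of crux stmt-QuantumFields-9735,
line Sketch)

The dissemination bookkeeping: the five analytic inputs of the line — the crude determinant bound,
the abstract chessboard estimate in letter form, marginal site-reflection positivity of the signed
det-weighted Wilson functional in the time axis, hypercubic (axis-exchange) covariance, and the
floor on the signed partition function — imply the crux
`Summit.QuantumFields.QCD.Theses.QuarksAsStableAction.UnquenchedChessboardBound`.

Normalisation (`Z_g` cancels), the concrete closed-unit-cell letters (auxiliary file 4), the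
reflection hypotheses in all four axes (files 2, 3), the universal-pattern bound (file 5) and the
final arithmetic (`L⁴`-th roots, `|R| ≤ 6 · #marked cells`, constants `C = (K^{12N_f} e^a)^{1/6}`,
`c = δ/192`).  All statements here are proved; no definitions are introduced.
-/

noncomputable section

open MeasureTheory Matrix Complex Finset
open Literature.MathematicalPhysics.QuantumFieldTheory Literature.MathematicalPhysics.QuantumLattice
open scoped ComplexConjugate BigOperators ComplexOrder

namespace Summit.QuantumFields.QCD.Theorems.UnquenchedChessboardBoundLine

/-- **Stub `assembly`.** The five analytic inputs imply the crux: normalise (`Z_g` cancels between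
numerator and denominator, both become integrals against `e^{-βS_W}∏dU`); encode `R` as a word of
closed-unit-cell letters (each plaquette assigned to the cell at its base point, `≤ 6` per cell, so
`≥ |R|/6` marked cells; letters = sets of cell plaquettes, the four involutions = corner-bit flips of
the unit cell); translation invariance gives cyclicity, `marginalRP` + `axisSwap` give the
reflection hypotheses in all four axes (Cauchy–Schwarz from positivity + Hermitian symmetry);
`chessboard` gives `|N̂_R|^{L⁴} ≤ Ẑ^{L⁴ - M} ∏_{marked} Φ(pattern)`; each universal pattern of a
non-empty letter has `≥ L⁴/16` distinct bad plaquettes, so `Φ(pattern) ≤ K^{12 N_f L⁴} e^{-βδL⁴/16}`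
by `detBound`, while `Ẑ ≥ e^{-(a+εβ)L⁴}` (`signedFloor`, `ε = δ/32`); taking `L⁴`-th roots gives
`(C e^{-cβ})^{|R|}` with `c = δ/192`. -/
theorem stub_assembly
    (hdet : ∀ {L : ℕ} [NeZero L] (U : GaugeConfig 4 L (Matrix.specialUnitaryGroup (Fin 3) ℂ)) (m : ℝ),
      ‖(wilsonDiracAP U m).det‖ ≤ (|m + 4| + 96) ^ (12 * L ^ 4))
    (hchess : ∀ {N : ℕ} [NeZero N], Even N → ∀ {α : Type} [Fintype α] [DecidableEq α]
      (r : Fin 4 → α → α), (∀ i, Function.Involutive (r i)) → (∀ i j a, r i (r j a) = r j (r i a)) →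
      ∀ Φ : ((Fin 4 → ZMod N) → α) → ℝ,
      (∀ (w : (Fin 4 → ZMod N) → α) (v : Fin 4 → ZMod N), Φ (fun c => w (c + v)) = Φ w) →
      (∀ (i : Fin 4) (w : (Fin 4 → ZMod N) → α),
        0 ≤ Φ (fun c => if (c i).val < N / 2 then w c else r i (w (Function.update c i (-1 - c i))))) →
      (∀ (i : Fin 4) (w : (Fin 4 → ZMod N) → α),
        Φ w ^ 2 ≤
          Φ (fun c => if (c i).val < N / 2 then w c else r i (w (Function.update c i (-1 - c i)))) *
          Φ (fun c => if (c i).val < N / 2 then r i (w (Function.update c i (-1 - c i))) else w c)) →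
      (∀ a : α, 0 ≤ Φ (fun c => (r 0)^[(c 0).val] ((r 1)^[(c 1).val] ((r 2)^[(c 2).val]
          ((r 3)^[(c 3).val] a))))) ∧
      ∀ w : (Fin 4 → ZMod N) → α,
        |Φ w| ^ (N ^ 4) ≤ ∏ c : Fin 4 → ZMod N, Φ (fun x => (r 0)^[(x 0).val] ((r 1)^[(x 1).val]
          ((r 2)^[(x 2).val] ((r 3)^[(x 3).val] (w c))))))
    (hrp : ∀ (Nf L : ℕ) [NeZero L] [Fact (1 < L)], Even L → 4 ≤ L → ∀ (β : ℝ) (m : Fin Nf → ℝ),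
      (∀ f, -1 < m f) → ∀ F : GaugeConfig 4 L (Matrix.specialUnitaryGroup (Fin 3) ℂ) → ℂ, WilsonSiteRP.IsHalfObs F →
      0 ≤ ∫ U, conj (F (GaugeConfig.negReflect U)) * F U *
          ((∏ f, (wilsonDiracAP U (m f)).det) * (Real.exp (-β * wilsonAction (fundamentalRep (Fin 3)) U) : ℂ))
        ∂(Measure.pi fun _ : Edge 4 L => haarProbability (Matrix.specialUnitaryGroup (Fin 3) ℂ)))
    (hswap : ∀ {L : ℕ} [NeZero L] (i : Fin 4) (U : GaugeConfig 4 L (Matrix.specialUnitaryGroup (Fin 3) ℂ)) (m : ℝ),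
      (wilsonDiracAP (fun e : Edge 4 L => U (e.1 ∘ Equiv.swap (0 : Fin 4) i, Equiv.swap (0 : Fin 4) i e.2))
          m).det = (wilsonDiracAP U m).det ∧
        wilsonAction (fundamentalRep (Fin 3)) (fun e : Edge 4 L => U (e.1 ∘ Equiv.swap (0 : Fin 4) i, Equiv.swap (0 : Fin 4) i e.2))
          = wilsonAction (fundamentalRep (Fin 3)) U)
    (hfloor : ∀ (Nf : ℕ) (mlo mhi ε : ℝ), -1 < mlo → 0 < ε →
      ∃ a : ℝ, ∀ β : ℝ, 0 ≤ β → ∀ (L : ℕ) [NeZero L], Even L → 4 ≤ L → ∀ m : Fin Nf → ℝ,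
        (∀ f, mlo ≤ m f ∧ m f ≤ mhi) →
        Real.exp (-((a + ε * β) * (L : ℝ) ^ 4)) ≤
          (∫ U, (∏ f, (wilsonDiracAP U (m f)).det) * (Real.exp (-β * wilsonAction (fundamentalRep (Fin 3)) U) : ℂ)
            ∂(Measure.pi fun _ : Edge 4 L => haarProbability (Matrix.specialUnitaryGroup (Fin 3) ℂ))).re) :
    Summit.QuantumFields.QCD.Theses.QuarksAsStableAction.UnquenchedChessboardBound := by
  intro Nf mlo mhi δ hmlo hδ
  -- ### constants
  obtain ⟨a, ha⟩ := hfloor Nf mlo mhi (δ / 32) hmlo (by positivity)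
  set K : ℝ := |mlo| + |mhi| + 100 with hK
  set A : ℝ := K ^ (12 * Nf) with hA
  set C₁ : ℝ := A * Real.exp a with hC₁
  set c₁ : ℝ := δ / 32 with hc₁
  have hK1 : 1 ≤ K := by rw [hK]; have := abs_nonneg mlo; have := abs_nonneg mhi; linarith
  have hA1 : 1 ≤ A := one_le_pow₀ hK1
  have hC₁pos : 0 < C₁ := mul_pos (by linarith) (Real.exp_pos a)
  have hc₁pos : 0 < c₁ := by positivity
  refine ⟨C₁ ^ ((1 : ℝ) / 6), c₁ / 6, max 0 (Real.log C₁ / c₁), by positivity, ?_⟩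
  intro β hβ L _ hL h4 apDet dfc m hm R
  have hβ0 : 0 ≤ β := le_trans (le_max_left _ _) hβ
  haveI : Fact (1 < L) := ⟨by omega⟩
  -- `x = C₁ e^{-c₁ β} ∈ (0, 1]`
  set x : ℝ := C₁ * Real.exp (-c₁ * β) with hx
  have hx0 : 0 < x := mul_pos hC₁pos (Real.exp_pos _)
  have hx1 : x ≤ 1 := by
    have h1 : Real.log C₁ / c₁ ≤ β := le_trans (le_max_right _ _) hβ
    rw [div_le_iff₀ hc₁pos] at h1
    have h2 : C₁ ≤ Real.exp (c₁ * β) := by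
      calc C₁ = Real.exp (Real.log C₁) := (Real.exp_log hC₁pos).symm
        _ ≤ Real.exp (c₁ * β) := Real.exp_le_exp.2 (by linarith)
    calc x = C₁ * Real.exp (-c₁ * β) := rfl
      _ ≤ Real.exp (c₁ * β) * Real.exp (-c₁ * β) :=
          mul_le_mul_of_nonneg_right h2 (Real.exp_pos _).le
      _ = 1 := by rw [← Real.exp_add]; simp
  -- ### the signed weight
  have hρ : Continuous (fundamentalRep (Fin 3)) := continuous_fundamentalRep (Fin 3)
  set W : GaugeConfig 4 L (Matrix.specialUnitaryGroup (Fin 3) ℂ) → ℂ := fun U =>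
    (∏ f, (wilsonDiracAP U (m f)).det) *
      (Real.exp (-β * wilsonAction (fundamentalRep (Fin 3)) U) : ℂ) with hWdef
  have hWm : Measurable W := (asm_continuous_signedWeight β m).measurable
  have hWb : ∃ C, ∀ U, ‖W U‖ ≤ C := asm_exists_norm_signedWeight_le β m
  have hWr : ∀ U, conj (W U) = W U := asm_conj_signedWeight β m
  have hWΘ : ∀ U, W (GaugeConfig.negReflect U) = W U := asm_signedWeight_negReflect hL β m
  have hWτ : ∀ v U, W (torusConfigShift v U) = W U := fun v U =>
    asm_signedWeight_torusConfigShift β m v U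
  have hWσ : ∀ (i : Fin 4) (U : GaugeConfig 4 L (Matrix.specialUnitaryGroup (Fin 3) ℂ)),
      W (fun e => U (e.1 ∘ Equiv.swap (0 : Fin 4) i, Equiv.swap (0 : Fin 4) i e.2)) = W U := by
    intro i U
    simp only [hWdef, (hswap i U 0).2]
    congr 1
    exact Finset.prod_congr rfl fun f _ => (hswap i U (m f)).1
  have hpos : ∀ F : GaugeConfig 4 L (Matrix.specialUnitaryGroup (Fin 3) ℂ) → ℂ,
      WilsonSiteRP.IsHalfObs F → 0 ≤ ∫ U, conj (F (GaugeConfig.negReflect U)) * F U * W U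
        ∂(Measure.pi fun _ : Edge 4 L => haarProbability (Matrix.specialUnitaryGroup (Fin 3) ℂ)) :=
    fun F hF => hrp Nf L hL h4 β m (fun f => lt_of_lt_of_le hmlo (hm f).1) F hF
  -- ### the signed partition function
  set Z : ℂ := ∫ U, W U
    ∂(Measure.pi fun _ : Edge 4 L => haarProbability (Matrix.specialUnitaryGroup (Fin 3) ℂ)) with hZ
  have hZfloor : Real.exp (-((a + δ / 32 * β) * (L : ℝ) ^ 4)) ≤ Z.re := ha β hβ0 L hL h4 m hm
  have hZpos : 0 < Z.re := lt_of_lt_of_le (Real.exp_pos _) hZfloor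
  have hZim : Z.im = 0 := by
    rw [← Complex.conj_eq_iff_im, hZ, ← integral_conj]
    exact integral_congr_ae (ae_of_all _ fun U => hWr U)
  -- ### letters, placement, involutions, word functional
  set pos : (Fin 4 → ZMod L) → (Fin 4 → Fin 2) × {p : Fin 4 × Fin 4 // p.1 < p.2} → Plaquette 4 L :=
    fun c q => ((c + fun k => if k = q.2.1.1 ∨ k = q.2.1.2 then 0 else ((q.1 k).val : ZMod L)), q.2)
    with hposdef
  set fl : Fin 4 → (Fin 4 → Fin 2) × {p : Fin 4 × Fin 4 // p.1 < p.2} →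
      (Fin 4 → Fin 2) × {p : Fin 4 × Fin 4 // p.1 < p.2} :=
    fun k q => (Function.update q.1 k (q.1 k + 1), q.2) with hfldef
  set r : Fin 4 → Finset ((Fin 4 → Fin 2) × {p : Fin 4 × Fin 4 // p.1 < p.2}) →
      Finset ((Fin 4 → Fin 2) × {p : Fin 4 × Fin 4 // p.1 < p.2}) := fun k s => s.image (fl k)
    with hrdef
  set Φ : ((Fin 4 → ZMod L) → Finset ((Fin 4 → Fin 2) × {p : Fin 4 × Fin 4 // p.1 < p.2})) → ℝ :=
    fun w => (∫ U, {U : GaugeConfig 4 L (Matrix.specialUnitaryGroup (Fin 3) ℂ) |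
      ∀ c, ∀ q ∈ w c, δ ≤ plaquetteDeficit (fundamentalRep (Fin 3)) U (pos c q)}.indicator 1 U * W U
      ∂(Measure.pi fun _ : Edge 4 L => haarProbability (Matrix.specialUnitaryGroup (Fin 3) ℂ))).re
    with hΦdef
  have hflinv : ∀ k, Function.Involutive (fl k) := fun k => asm_bitFlip_involutive k
  have hr : ∀ i, Function.Involutive (r i) := fun i s => by
    simp only [hrdef, Finset.image_image, (hflinv i).comp_self, Finset.image_id]
  have hrc : ∀ i j s, r i (r j s) = r j (r i s) := fun i j s => by
    simp only [hrdef, Finset.image_image]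
    exact Finset.image_congr fun q _ => asm_bitFlip_comm i j q
  have hps : ∀ c v q, pos (c + v) q = ((pos c q).1 + v, (pos c q).2) := fun c v q => asm_pos_add c v q
  have hpr : ∀ c q, WilsonSiteRP.sitePlaqReflect (pos c q) =
      pos (Function.update c 0 (-1 - c 0)) (fl 0 q) := fun c q => asm_sitePlaqReflect_pos c q
  have hloc : ∀ c q, (c 0).val < L / 2 →
      WilsonSiteRP.IsSitePosPlaq (pos c q) ∨ WilsonSiteRP.IsSharedPlaq (pos c q) :=
    fun c q hc => asm_pos_half hL c q hc
  have hfib : ∀ y q k, (pos y q).1 k = y k ∨ (pos y q).1 k = y k + 1 := fun y q k =>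
    asm_pos_fst_apply y q k
  -- ### hypotheses of the chessboard estimate
  have hcyc : ∀ (w : (Fin 4 → ZMod L) → Finset ((Fin 4 → Fin 2) × {p : Fin 4 × Fin 4 // p.1 < p.2}))
      (v : Fin 4 → ZMod L), Φ (fun c => w (c + v)) = Φ w := fun w v =>
    asm_phi_shift (fundamentalRep (Fin 3)) δ pos hps W hWτ w v
  have haxis : ∀ (i : Fin 4)
      (w : (Fin 4 → ZMod L) → Finset ((Fin 4 → Fin 2) × {p : Fin 4 × Fin 4 // p.1 < p.2})),
      0 ≤ Φ (fun c => if (c i).val < L / 2 then w c else r i (w (Function.update c i (-1 - c i)))) ∧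
      Φ w ^ 2 ≤
        Φ (fun c => if (c i).val < L / 2 then w c else r i (w (Function.update c i (-1 - c i)))) *
        Φ (fun c => if (c i).val < L / 2 then r i (w (Function.update c i (-1 - c i))) else w c) := by
    intro i w
    obtain ⟨sw, hsw, hcomm⟩ := asm_exists_swapLabel (L := L)
      (G := Matrix.specialUnitaryGroup (Fin 3) ℂ) (fundamentalRep (Fin 3)) hρ i
    exact chess_axis (fundamentalRep (Fin 3)) δ pos hL hρ i (fl0 := fl 0) (fli := fl i) (sw := sw)
      (hflinv 0) hpr hloc hsw hcomm W hWm hWb hWr hWΘ (hWσ i) hpos w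
  obtain ⟨hpat, hboard⟩ := hchess hL r hr hrc Φ hcyc (fun i w => (haxis i w).1) (fun i w => (haxis i w).2)
  -- ### the universal-pattern bound
  have hρu : ∀ g, fundamentalRep (Fin 3) g ∈ Matrix.unitaryGroup (Fin 3) ℂ :=
    fun g => fundamentalRep_mem_unitaryGroup g
  have hE : A ^ (L ^ 4) * Real.exp (-β * (δ * (L : ℝ) ^ 4 / 16)) =
      x ^ (L ^ 4) * Real.exp (-((a + δ / 32 * β) * (L : ℝ) ^ 4)) := by
    rw [hx, hC₁, hc₁, mul_pow, mul_pow, ← Real.exp_nat_mul, ← Real.exp_nat_mul, mul_assoc, mul_assoc,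
      ← Real.exp_add, ← Real.exp_add]
    congr 1
    push_cast
    ring
  have hpatbd : ∀ s : Finset ((Fin 4 → Fin 2) × {p : Fin 4 × Fin 4 // p.1 < p.2}), s.Nonempty →
      Φ (fun y => (r 0)^[(y 0).val] ((r 1)^[(y 1).val] ((r 2)^[(y 2).val] ((r 3)^[(y 3).val] s)))) ≤
        x ^ (L ^ 4) * Z.re := by
    intro s hs
    have hw : ∀ y : Fin 4 → ZMod L, ((r 0)^[(y 0).val] ((r 1)^[(y 1).val] ((r 2)^[(y 2).val]
        ((r 3)^[(y 3).val] s)))).Nonempty := fun y =>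
      asm_pattern_nonempty (fl 0) (fl 1) (fl 2) (fl 3) hs _ _ _ _
    refine le_trans (asm_re_integral_indicator_mul_le _ _ W (E := A ^ (L ^ 4) *
      Real.exp (-β * (δ * (L : ℝ) ^ 4 / 16))) (by positivity) fun U hU => ?_) ?_
    · have hs16 := asm_mul_pow_le_wilsonAction (fundamentalRep (Fin 3)) δ pos hρu hδ.le hfib _ hw U hU
      exact asm_norm_signedWeight_le_of_action_ge hdet hβ0 m hm U (by linarith)
    · rw [hE]
      exact mul_le_mul_of_nonneg_left hZfloor (pow_nonneg hx0.le _)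
  have hpat0 : Φ (fun y => (r 0)^[(y 0).val] ((r 1)^[(y 1).val] ((r 2)^[(y 2).val]
      ((r 3)^[(y 3).val] ∅)))) = Z.re := by
    have h0 : ∀ (k : Fin 4) (n : ℕ), (r k)^[n] ∅ = ∅ := fun k n =>
      Function.iterate_fixed (Finset.image_empty _) n
    simp only [h0, hΦdef, Finset.notMem_empty, false_imp_iff, imp_true_iff,
      Set.setOf_true, Set.indicator_univ, Pi.one_apply, one_mul]
    rw [hZ]
  -- ### the marking word of `R` and the chessboard estimate
  set wR : (Fin 4 → ZMod L) → Finset ((Fin 4 → Fin 2) × {p : Fin 4 × Fin 4 // p.1 < p.2}) :=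
    fun c => Finset.univ.filter fun q => q.1 = 0 ∧ (c, q.2) ∈ R with hwRdef
  set M : ℕ := (Finset.univ.filter fun c : Fin 4 → ZMod L => ¬ (wR c = ∅)).card with hMdef
  have hRM : R.card ≤ 6 * M := asm_card_le_six_mul_card_marked R
  have hL4 : Fintype.card (Fin 4 → ZMod L) = L ^ 4 := asm_card_cells
  have hkey : |Φ wR| ≤ Z.re * x ^ M := by
    have h1 := hboard wR
    have h2 : ∏ c : Fin 4 → ZMod L, Φ (fun y => (r 0)^[(y 0).val] ((r 1)^[(y 1).val]
        ((r 2)^[(y 2).val] ((r 3)^[(y 3).val] (wR c))))) ≤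
        ∏ c : Fin 4 → ZMod L, (if wR c = ∅ then Z.re else x ^ (L ^ 4) * Z.re) := by
      refine Finset.prod_le_prod (fun c _ => hpat _) fun c _ => ?_
      split_ifs with hc
      · rw [hc, hpat0]
      · exact hpatbd _ (Finset.nonempty_iff_ne_empty.2 hc)
    have h3 : ∏ c : Fin 4 → ZMod L, (if wR c = ∅ then Z.re else x ^ (L ^ 4) * Z.re) =
        (Z.re * x ^ M) ^ (L ^ 4) := by
      have hsum : (Finset.univ.filter fun c : Fin 4 → ZMod L => wR c = ∅).card + M = L ^ 4 := by
        rw [hMdef, Finset.card_filter_add_card_filter_not, Finset.card_univ, hL4]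
      rw [Finset.prod_ite, Finset.prod_const, Finset.prod_const, ← hMdef, ← hsum]
      ring
    rw [h3] at h2
    have h4 : L ^ 4 ≠ 0 := pow_ne_zero 4 (by omega)
    exact (pow_le_pow_iff_left₀ (abs_nonneg _) (by positivity) h4).1 (h1.trans h2)
  -- ### from marked cells to `|R|`
  have hxM : x ^ M ≤ (C₁ ^ ((1 : ℝ) / 6) * Real.exp (-(c₁ / 6) * β)) ^ R.card := by
    have h1 : (C₁ ^ ((1 : ℝ) / 6) * Real.exp (-(c₁ / 6) * β)) ^ R.card = x ^ ((R.card : ℝ) / 6) := by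
      rw [hx, Real.mul_rpow hC₁pos.le (Real.exp_pos _).le, mul_pow, ← Real.rpow_mul_natCast hC₁pos.le,
        ← Real.exp_nat_mul, ← Real.exp_mul]
      congr 1
      · congr 1; ring
      · congr 1; ring
    rw [h1, ← Real.rpow_natCast]
    refine Real.rpow_le_rpow_of_exponent_ge hx0 hx1 ?_
    rw [div_le_iff₀ (by norm_num : (0 : ℝ) < 6)]
    exact_mod_cast (mul_comm 6 M ▸ hRM)
  -- ### normalisation and conclusion
  have h1 : apDet = fun U m => (wilsonDiracAP U m).det := rfl
  have h2 : dfc = fun U p => plaquetteDeficit (fundamentalRep (Fin 3)) U p := by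
    funext U p
    simp only [dfc, plaquetteDeficit, Nat.cast_ofNat]
  simp only [h1, h2]
  have hevent : {U : GaugeConfig 4 L (Matrix.specialUnitaryGroup (Fin 3) ℂ) |
      ∀ p ∈ R, δ ≤ plaquetteDeficit (fundamentalRep (Fin 3)) U p} =
      {U | ∀ c, ∀ q ∈ wR c, δ ≤ plaquetteDeficit (fundamentalRep (Fin 3)) U (pos c q)} :=
    (asm_markEvent_eq (fundamentalRep (Fin 3)) δ R).symm
  have hmeas : MeasurableSet {U : GaugeConfig 4 L (Matrix.specialUnitaryGroup (Fin 3) ℂ) |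
      ∀ p ∈ R, δ ≤ plaquetteDeficit (fundamentalRep (Fin 3)) U p} := by
    rw [hevent]
    exact asm_measurableSet_wordEvent' (fundamentalRep (Fin 3)) δ pos hρ wR
  rw [asm_setIntegral_wilsonMeasure_eq (fundamentalRep (Fin 3)) hρ β _ hmeas,
    asm_integral_wilsonMeasure_eq (fundamentalRep (Fin 3)) hρ β]
  have hnum : ∫ U, (Real.exp (-β * wilsonAction (fundamentalRep (Fin 3)) U) : ℂ) *
      {U : GaugeConfig 4 L (Matrix.specialUnitaryGroup (Fin 3) ℂ) |
        ∀ p ∈ R, δ ≤ plaquetteDeficit (fundamentalRep (Fin 3)) U p}.indicator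
        (fun U => ∏ f, (wilsonDiracAP U (m f)).det) U
      ∂(Measure.pi fun _ : Edge 4 L => haarProbability (Matrix.specialUnitaryGroup (Fin 3) ℂ)) =
      ∫ U, {U | ∀ c, ∀ q ∈ wR c, δ ≤ plaquetteDeficit (fundamentalRep (Fin 3)) U (pos c q)}.indicator 1 U
        * W U ∂(Measure.pi fun _ : Edge 4 L => haarProbability (Matrix.specialUnitaryGroup (Fin 3) ℂ)) := by
    rw [← hevent]
    refine integral_congr_ae (ae_of_all _ fun U => ?_)
    beta_reduce
    by_cases hU : U ∈ {U : GaugeConfig 4 L (Matrix.specialUnitaryGroup (Fin 3) ℂ) |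
        ∀ p ∈ R, δ ≤ plaquetteDeficit (fundamentalRep (Fin 3)) U p}
    · rw [Set.indicator_of_mem hU, Set.indicator_of_mem hU, hWdef]
      simp only [Pi.one_apply, one_mul]
      ring
    · rw [Set.indicator_of_notMem hU, Set.indicator_of_notMem hU]
      simp
  have hden : ∫ U, (Real.exp (-β * wilsonAction (fundamentalRep (Fin 3)) U) : ℂ) *
      ∏ f, (wilsonDiracAP U (m f)).det
      ∂(Measure.pi fun _ : Edge 4 L => haarProbability (Matrix.specialUnitaryGroup (Fin 3) ℂ)) = Z := by
    rw [hZ]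
    refine integral_congr_ae (ae_of_all _ fun U => ?_)
    beta_reduce
    rw [hWdef]
    ring
  rw [hnum, hden]
  refine asm_norm_div_le_of_le (by positivity) hZpos hZim ?_
  -- the numerator is real, with real part `Φ wR`
  have hNreal : conj (∫ U, {U | ∀ c, ∀ q ∈ wR c,
      δ ≤ plaquetteDeficit (fundamentalRep (Fin 3)) U (pos c q)}.indicator 1 U * W U
      ∂(Measure.pi fun _ : Edge 4 L => haarProbability (Matrix.specialUnitaryGroup (Fin 3) ℂ))) =
      ∫ U, {U | ∀ c, ∀ q ∈ wR c, δ ≤ plaquetteDeficit (fundamentalRep (Fin 3)) U (pos c q)}.indicator 1 U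
        * W U ∂(Measure.pi fun _ : Edge 4 L => haarProbability (Matrix.specialUnitaryGroup (Fin 3) ℂ)) := by
    rw [← integral_conj]
    refine integral_congr_ae (ae_of_all _ fun U => ?_)
    beta_reduce
    rw [map_mul, hWr]
    congr 1
    simp only [Set.indicator_apply, Pi.one_apply]
    split_ifs <;> simp
  rw [← Complex.re_add_im (∫ U, _ ∂_), Complex.conj_eq_iff_im.1 hNreal]
  simp only [Complex.ofReal_zero, zero_mul, add_zero, Complex.norm_real, Real.norm_eq_abs]
  exact hkey.trans (mul_le_mul_of_nonneg_left hxM hZpos.le)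


end Summit.QuantumFields.QCD.Theorems.UnquenchedChessboardBoundLine

end
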